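import Literature.Topology.PlaneTopology.PlusCrossing
import Literature.Topology.PlaneTopology.RectangleDuality
import HarnessLib

/-!
# A closed set separating two vertical crossings of a rectangle crosses it vertically

Topic: Topology / PlaneTopology.  The continuum form of "the interface between an open
vertical crossing and a closed vertical crossing of a rectangle is itself a vertical crossing"
(F. Camia, C. M. Newman, Comm. Math. Phys. 268 (2006), §5: the exploration path between a blue
and a yellow crossing; O. Schramm, S. Smirnov, Ann. Probab. 39 (2011), proof of Lemma 6.1: planar
duality for continuum crossings), complementing `RectangleDuality.lean` and `PlusCrossing.lean`:

* `exists_path_avoiding_of_not_crossed_horizontal` — the transposed dual path: if a compact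
  `𝒦 ⊆ [a, b] × [c, d]` contains no connected set meeting both horizontal sides, some path in the
  rectangle joins the two vertical sides off `𝒦` (`exists_path_avoiding_of_not_crossed`
  transported by the swap of coordinates);
* `exists_crossing_continuum_of_separated` — **separated crossings**: let `T` be closed and let
  `P`, `Q` be compact connected sets inside the vertical strip `a ≤ re ≤ b`, each meeting
  `{im ≤ c}` and `{d ≤ im}`, such that no connected set disjoint from `T` meets both `P` and `Q`.
  Then `T ∩ ([a, b] × [c, d])` contains a compact connected set meeting the lines `im = c` and
  `im = d`.  (Otherwise the transposed dual path, a continuum joining the vertical sides off `T`,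
  meets the clipped crossings `P`, `Q` by `inter_nonempty_of_crossing_continua`.)

## References

* F. Camia, C. M. Newman, Comm. Math. Phys. 268 (2006), §5. [CamiaNewman2006]
* O. Schramm, S. Smirnov, Ann. Probab. 39 (2011), proof of Lemma 6.1. [SchrammSmirnov2011]
* M. H. A. Newman, *Elements of the topology of plane sets of points* (1939), Ch. V §11. [Newman1939]
-/

noncomputable section

namespace Literature.Topology.PlaneTopology

open Complex Set Metric Filter Function _root_.Topology

variable {a b c d : ℝ}

/-! ### The transposed dual path -/

/-- **The dual path, transposed.**  If a compact `𝒦 ⊆ [a, b] × [c, d]` (`a < b`, `c < d`)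
contains no connected subset meeting both horizontal sides `im = c`, `im = d`, then some path in
the rectangle joins the left side `re = a` to the right side `re = b` without meeting `𝒦`.
[cite: SchrammSmirnov2011, proof of Lemma 6.1] -/
theorem exists_path_avoiding_of_not_crossed_horizontal {𝒦 : Set ℂ} (hab : a < b) (hcd : c < d)
    (h𝒦 : IsCompact 𝒦) (h𝒦sub : 𝒦 ⊆ Icc a b ×ℂ Icc c d)
    (h : ∀ C ⊆ 𝒦, IsPreconnected C → (∃ z ∈ C, z.im = c) → (∃ z ∈ C, z.im = d) → False) :
    ∃ γ : ℝ → ℂ, ContinuousOn γ (Icc 0 1) ∧ MapsTo γ (Icc 0 1) (Icc a b ×ℂ Icc c d) ∧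
      (γ 0).re = a ∧ (γ 1).re = b ∧ ∀ t ∈ Icc (0 : ℝ) 1, γ t ∉ 𝒦 := by
  set σ : ℂ → ℂ := fun z => (⟨z.im, z.re⟩ : ℂ) with hσ
  have hσc : Continuous σ := continuous_swap
  have hσσ : ∀ z, σ (σ z) = z := fun z => rfl
  have hσR : ∀ {z : ℂ}, z ∈ Icc a b ×ℂ Icc c d → σ z ∈ Icc c d ×ℂ Icc a b := fun {z} hz => by
    rw [mem_reProdIm] at hz ⊢
    exact ⟨hz.2, hz.1⟩
  obtain ⟨γ, hγc, hγm, hγ0, hγ1, hγ𝒦⟩ := exists_path_avoiding_of_not_crossed (𝒦 := σ '' 𝒦) hcd hab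
    (h𝒦.image hσc) (by rintro _ ⟨z, hz, rfl⟩; exact hσR (h𝒦sub hz)) (fun C hC hCc hCa hCb => by
      refine h (σ '' C) ?_ (hCc.image _ hσc.continuousOn) ?_ ?_
      · rintro _ ⟨z, hz, rfl⟩
        obtain ⟨w, hw, rfl⟩ := hC hz
        rwa [hσσ]
      · obtain ⟨z, hz, hza⟩ := hCa
        exact ⟨σ z, mem_image_of_mem _ hz, hza⟩
      · obtain ⟨z, hz, hzb⟩ := hCb
        exact ⟨σ z, mem_image_of_mem _ hz, hzb⟩)
  refine ⟨fun t => σ (γ t), hσc.comp_continuousOn hγc, fun t ht => ?_, hγ0, hγ1,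
    fun t ht hmem => hγ𝒦 t ht ?_⟩
  · have := hγm ht
    rw [mem_reProdIm] at this ⊢
    exact ⟨this.2, this.1⟩
  · exact ⟨σ (γ t), hmem, hσσ _⟩

/-! ### Separated crossings -/

/-- **A closed set separating two vertical crossings crosses vertically.**  Let `a < b`,
`c < d`, `T ⊆ ℂ` closed, and `P, Q ⊆ ℂ` compact connected sets inside the strip
`a ≤ re ≤ b`, each meeting `{im ≤ c}` and `{d ≤ im}`.  If no connected set disjoint from `T`
meets both `P` and `Q`, then there is a compact connected `C ⊆ T ∩ ([a, b] × [c, d])` meeting the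
lines `im = c` and `im = d` (Camia–Newman 2006, §5: the interface between crossings of opposite
colours crosses the quad; continuum duality, Schramm–Smirnov 2011, Lemma 6.1).
[cite: CamiaNewman2006, §5] -/
theorem exists_crossing_continuum_of_separated {T P Q : Set ℂ} (hab : a < b) (hcd : c < d)
    (hT : IsClosed T)
    (hP : IsCompact P) (hPc : IsPreconnected P) (hPstrip : ∀ z ∈ P, a ≤ z.re ∧ z.re ≤ b)
    (hPbot : ∃ z ∈ P, z.im ≤ c) (hPtop : ∃ z ∈ P, d ≤ z.im)
    (hQ : IsCompact Q) (hQc : IsPreconnected Q) (hQstrip : ∀ z ∈ Q, a ≤ z.re ∧ z.re ≤ b)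
    (hQbot : ∃ z ∈ Q, z.im ≤ c) (hQtop : ∃ z ∈ Q, d ≤ z.im)
    (hsep : ∀ S : Set ℂ, IsPreconnected S → Disjoint S T → (S ∩ P).Nonempty →
      (S ∩ Q).Nonempty → False) :
    ∃ C ⊆ T ∩ (Icc a b ×ℂ Icc c d), IsCompact C ∧ IsPreconnected C ∧ (∃ z ∈ C, z.im = c) ∧
      ∃ z ∈ C, z.im = d := by
  set 𝒦 : Set ℂ := T ∩ (Icc a b ×ℂ Icc c d) with h𝒦
  have hRc : IsCompact (Icc a b ×ℂ Icc c d) := isCompact_Icc.reProdIm isCompact_Icc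
  have h𝒦c : IsCompact 𝒦 := hRc.inter_left hT
  by_cases hex : ∃ C ⊆ 𝒦, IsPreconnected C ∧ (∃ z ∈ C, z.im = c) ∧ ∃ z ∈ C, z.im = d
  · obtain ⟨C, hC𝒦, hCc, ⟨u, hu, huim⟩, ⟨v, hv, hvim⟩⟩ := hex
    have hcl : closure C ⊆ 𝒦 := closure_minimal hC𝒦 h𝒦c.isClosed
    exact ⟨closure C, hcl, h𝒦c.of_isClosed_subset isClosed_closure hcl, hCc.closure,
      ⟨u, subset_closure hu, huim⟩, ⟨v, subset_closure hv, hvim⟩⟩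
  exfalso
  obtain ⟨γ, hγc, hγm, hγ0, hγ1, hγ𝒦⟩ := exists_path_avoiding_of_not_crossed_horizontal hab hcd h𝒦c
    inter_subset_right (fun C hC hCc hCa hCb => hex ⟨C, hC, hCc, hCa, hCb⟩)
  -- the dual path as a continuum joining the vertical sides
  set K : Set ℂ := γ '' Icc 0 1 with hK
  have hKc : IsCompact K := isCompact_Icc.image_of_continuousOn hγc
  have hKp : IsPreconnected K := isPreconnected_Icc.image _ hγc
  have hKsub : K ⊆ Icc a b ×ℂ Icc c d := by
    rintro _ ⟨t, ht, rfl⟩; exact hγm ht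
  have hKa : ∃ z ∈ K, z.re = a := ⟨γ 0, mem_image_of_mem _ (left_mem_Icc.2 zero_le_one), hγ0⟩
  have hKb : ∃ z ∈ K, z.re = b := ⟨γ 1, mem_image_of_mem _ (right_mem_Icc.2 zero_le_one), hγ1⟩
  have hKT : Disjoint K T := by
    refine disjoint_left.2 ?_
    rintro _ ⟨t, ht, rfl⟩ hT'
    exact hγ𝒦 t ht ⟨hT', hγm ht⟩
  -- it meets the clipped crossings `P` and `Q`
  have hmeet : ∀ {L : Set ℂ}, IsCompact L → IsPreconnected L → (∀ z ∈ L, a ≤ z.re ∧ z.re ≤ b) →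
      (∃ z ∈ L, z.im ≤ c) → (∃ z ∈ L, d ≤ z.im) → (K ∩ L).Nonempty := by
    intro L hL hLc hLstrip hLbot hLtop
    obtain ⟨L', hL'sub, hL'c, hL'p, hL'band, hL'c', hL'd⟩ :=
      exists_subcontinuum_between_hlines hcd.le hL hLc hLbot hLtop
    have hL'R : L' ⊆ Icc a b ×ℂ Icc c d := fun z hz =>
      mem_reProdIm.2 ⟨hLstrip z (hL'sub hz), hL'band z hz⟩
    obtain ⟨z, hzK, hzL'⟩ := inter_nonempty_of_crossing_continua hab.le hcd.le hKc hKp hKsub hKa hKb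
      hL'c hL'p hL'R hL'c' hL'd
    exact ⟨z, hzK, hL'sub hzL'⟩
  exact hsep K hKp hKT (hmeet hP hPc hPstrip hPbot hPtop) (hmeet hQ hQc hQstrip hQbot hQtop)

end Literature.Topology.PlaneTopology
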